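import Summits.NavierStokesRegularity.NavierStokesRegularity.Theorems.TypeIliouvilleNoTypeII.Negative.NSISuperCascadePowerGauges
import Summits.NavierStokesRegularity.NavierStokesRegularity.Theorems.TypeIliouvilleNoTypeII.Negative.NSISuperCascadePortrait
import HarnessLib

/-!
# The super-similar NSI cascade is a power-zoomable Type-II portrait (Seregin's scenario, in NSI)

Negative-lane support file for `stmt-NavierStokesRegularity-0056` (kill-kit, model class M2′),
bearing on the §B route `EulerZoomLiouville` (`TypeIOrPowerZoomable`, `SereginZoomReduction`,
crux `PowerGaugeEulerLiouville`). Those items single out a Type-II candidate `z₀` by four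
hypotheses: (G1) suitable weak NS solution near `z₀`; (G2) a weak spatial gradient on the parabolic
cylinders at `z₀`; (G3) the power-gauge bound `r^{2ρ}A + r^{ρ}E + r^{2ρ}D ≤ M`, `0 < r ≤ r₀`
(Seregin, arXiv:2402.13229, (1.7)); (G4) the `L³` floor on the Euler cylinders
`Q^{ρ}_r = (t₀ - r^{2+ρ}, t₀) × B_r(x₀)`: `r^{2ρ-2} ∫_{Q^{ρ}_r} |v|³ ≥ ε₀` along `r → 0`
(arXiv:2402.13229, (3.1)).

Here: the super-similar NSI cascade `𝔲 = glueG T σ τ a z u` of an `IsSuperBlock` datum with power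
exponent `ρ` (`a = τ^{-(1+ρ)}`, `NSISuperCascadeEulerScaling`) satisfies, at its blow-up point
`(T₀, x₀)`, (G2) (`hasWeakSpatialGradientOn_glueG_cylinder`), the `A`- and `E`-parts of (G3) at
every scale (`NSISuperCascadePowerGauges`), and (G4) EXACTLY — by its discrete Euler
self-similarity the normalised `L³` mass of `Q^{ρ}_{r_j}`, `r_j = R τʲ`, is bounded below by the
constant contribution of the `j`-th strip (`exists_eulerCylinder_L3_floor`) — while being a weak
solution of the Navier–Stokes INEQUALITY for all `ν ∈ [0, ν₀]` whose blow-up at `T₀` is not of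
Type I (`powerZoomable_portrait`, `exists_weakNSI_powerZoomable`).

Kill-kit reading (K3/BC8, by name, for the route's tribunal and lead): every hypothesis of
`SereginZoomReduction` except the Navier–Stokes identity (G1) (and the pressure part of (G3),
treated separately) is met inside the NSI class by an object that does blow up; an exclusion of the
power-zoomable portrait — in particular the crux `PowerGaugeEulerLiouville` fed through Seregin's
zoom — must therefore use the identity, not the local energy inequality and gauge bookkeeping.
WHAT THIS IS NOT: not a statement about Navier–Stokes or Euler solutions; no new definitions.

References: Seregin, arXiv:2402.13229 (2024), (1.7)–(1.8), (3.1); arXiv:2409.07625 (2024),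
Thm. 1.3; Ożański, arXiv:1709.00602 (2017), §2 [`Ozanski2017NSISingular`]; CKN 1982, (2.1)–(2.6).
-/

noncomputable section

open MeasureTheory Set Function Filter Topology Metric Module
open scoped ENNReal

set_option linter.dupNamespace false

namespace Summit.NavierStokesRegularity.NavierStokesRegularity.Theorems.TypeIliouvilleNoTypeIINegative

open Literature.Analysis.FluidPDE Literature.Barriers.NavierStokesRegularity
open Literature.Barriers.NavierStokesRegularity.Scheffer TopologicalSpace

namespace IsSuperBlock

variable {T ν₀ τ σ a : ℝ} {z : EuclideanSpace ℝ (Fin 3)} {G : Set (EuclideanSpace ℝ (Fin 3))}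
  {u : ℝ → EuclideanSpace ℝ (Fin 3) → EuclideanSpace ℝ (Fin 3)} {ρ : ℝ}

/-! ### (G2) The slice derivative is a weak spatial gradient, on `(0,∞) × ℝ³` and on cylinders -/

/-- `T₀ > 0`. [folklore] -/
theorem blowupTime_pos' (h : IsSuperBlock T ν₀ τ σ a z G u) : 0 < blowupTime T σ :=
  div_pos h.T_pos (by nlinarith [h.σ_sq_lt_one])

/-- **`D𝔲` is a weak spatial gradient of `𝔲` on `(0,∞) × ℝ³`** (piecewise integration by parts,
`hasWeakSpatialGradientOn_of_piecewise`). [cite: Ozanski2017NSISingular, §2 p. 7] -/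
theorem hasWeakSpatialGradientOn_glueG (h : IsSuperBlock T ν₀ τ σ a z G u) :
    HasWeakSpatialGradientOn (positiveTimes : Opens (ℝ × EuclideanSpace ℝ (Fin 3)))
      (glueG T σ τ a z u) (fun s x => fderiv ℝ (glueG T σ τ a z u s) x) := by
  refine hasWeakSpatialGradientOn_of_piecewise (t := switchTime T σ) (T₀ := blowupTime T σ)
    (v := fun j => pieceG T σ τ a z u j) (strictMono_switchTime h.T_pos h.σ_pos)
    (switchTime_zero T σ) (tendsto_switchTime h.σ_pos.le h.σ_lt_one) ?_ ?_ ?_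
    h.integrableOn_glueG h.integrableOn_fderiv_glueG
  · intro j s hs
    have e := glueG_eq_pieceG h.T_pos h.σ_pos τ a z u hs
    exact ⟨e, by simp only [e]⟩
  · intro s hs
    have e := glueG_eq_zero_of_le h.T_pos h.σ_pos h.σ_lt_one τ a z u hs
    refine ⟨e, ?_⟩
    funext x
    simp only [e]
    exact fderiv_const_apply _
  · exact fun j s hs => (h.contDiff_pieceG_slice (Ico_subset_Icc_self hs)).of_le (by norm_cast)

/-- **(G2) at the blow-up point**: `D𝔲` is a weak spatial gradient of `𝔲` on every parabolic
cylinder `Q_r(T₀, x')` with `r² ≤ T₀` (these lie in `(0,∞) × ℝ³`). [folklore] -/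
theorem hasWeakSpatialGradientOn_glueG_cylinder (h : IsSuperBlock T ν₀ τ σ a z G u) {r : ℝ}
    (hr : r ^ 2 ≤ blowupTime T σ) (x' : EuclideanSpace ℝ (Fin 3)) :
    HasWeakSpatialGradientOn (parabolicCylinderOpens r (blowupTime T σ, x'))
      (glueG T σ τ a z u) (fun s x => fderiv ℝ (glueG T σ τ a z u s) x) := by
  refine h.hasWeakSpatialGradientOn_glueG.mono fun q hq => ?_
  have hq' : q ∈ parabolicCylinder r (blowupTime T σ, x') := hq
  rw [mem_parabolicCylinder] at hq'
  change q ∈ ((positiveTimes : Opens (ℝ × EuclideanSpace ℝ (Fin 3))) : Set (ℝ × EuclideanSpace ℝ (Fin 3)))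
  rw [coe_positiveTimes]
  exact ⟨show (0 : ℝ) < q.1 by linarith [hq'.1.1], mem_univ _⟩

/-! ### Spatial localisation of the strips about the blow-up point -/

/-- **The `j`-th piece lives in the ball `B(x₀, τʲR)`**: if `G ⊆ B(x₀, R)` (`x₀ = blowupPoint τ z`)
then `𝔲(t, x) ≠ 0` with `t` on the `j`-th strip forces `dist x x₀ < τʲ R`.
[cite: Ozanski2017NSISingular, §2.1 (p. 6)] -/
theorem dist_lt_of_glueG_ne_zero (h : IsSuperBlock T ν₀ τ σ a z G u) {R : ℝ}
    (hR : G ⊆ ball (blowupPoint τ z) R) {t : ℝ} {j : ℕ}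
    (hj : t ∈ Ico (switchTime T σ j) (switchTime T σ (j + 1))) {x : EuclideanSpace ℝ (Fin 3)}
    (hx : glueG T σ τ a z u t x ≠ 0) : dist x (blowupPoint τ z) < τ ^ j * R := by
  have hτ := h.τ_pos
  rw [glueG_eq_pieceG h.T_pos h.σ_pos τ a z u hj, pieceG_slice_eq_smul_comp_affine] at hx
  beta_reduce at hx
  have hs : (σ⁻¹) ^ (2 * j) * (t - switchTime T σ j) ∈ Icc 0 T := by
    convert h.localTime_mem (Ico_subset_Icc_self hj) using 1; ring
  set y : EuclideanSpace ℝ (Fin 3) := (1 - (τ⁻¹) ^ j) • (1 - τ)⁻¹ • z + (τ⁻¹) ^ j • x with hy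
  have hyG : y ∈ G := by
    by_contra hyG
    exact hx (by rw [h.block.apply_eq_zero_of_notMem hs hyG, smul_zero])
  have hyx : y - blowupPoint τ z = (τ⁻¹) ^ j • (x - blowupPoint τ z) := by
    simp only [hy, blowupPoint, smul_sub, sub_smul, one_smul]
    abel
  have h1 := hR hyG
  rw [mem_ball, dist_eq_norm, hyx, norm_smul, Real.norm_of_nonneg (h.inv_tau_pow_pos j).le,
    inv_pow] at h1
  rw [dist_eq_norm]
  calc ‖x - blowupPoint τ z‖ = τ ^ j * ((τ ^ j)⁻¹ * ‖x - blowupPoint τ z‖) := by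
        rw [← mul_assoc, mul_inv_cancel₀ (pow_ne_zero _ hτ.ne'), one_mul]
    _ < τ ^ j * R := mul_lt_mul_of_pos_left h1 (pow_pos hτ j)

/-! ### The base `L³` mass is positive and finite -/

/-- **`0 < ∫₀ᵀ∫ |u|³`**: the block is uniformly non-trivial (`exists_pos_forall_exists_le_norm`) and
jointly continuous, so `|u| > m/2` on an open space–time set of positive measure. [folklore] -/
theorem base_lintegral_norm_cube_ne_zero (h : IsSuperBlock T ν₀ τ σ a z G u) :
    (∫⁻ q in Ico 0 T ×ˢ (univ : Set (EuclideanSpace ℝ (Fin 3))), ‖u q.1 q.2‖ₑ ^ (3 : ℕ)) ≠ 0 := by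
  obtain ⟨m, hm, hmu⟩ := exists_pos_forall_exists_le_norm h.block
  have hs₀ : T / 2 ∈ Ioo 0 T := ⟨by linarith [h.T_pos], by linarith [h.T_pos]⟩
  obtain ⟨x₁, hx₁⟩ := hmu (T / 2) (Ioo_subset_Icc_self hs₀)
  have hcont : ContinuousOn (fun q : ℝ × EuclideanSpace ℝ (Fin 3) => ‖u q.1 q.2‖) (Icc 0 T ×ˢ univ) :=
    h.block.continuousOn_uncurry.norm
  have hq₀ : Ioo 0 T ×ˢ (univ : Set (EuclideanSpace ℝ (Fin 3))) ∈
      𝓝 ((T / 2, x₁) : ℝ × EuclideanSpace ℝ (Fin 3)) :=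
    (isOpen_Ioo.prod isOpen_univ).mem_nhds ⟨hs₀, mem_univ _⟩
  have hFat : ContinuousAt (fun q : ℝ × EuclideanSpace ℝ (Fin 3) => ‖u q.1 q.2‖) (T / 2, x₁) :=
    hcont.continuousAt (mem_of_superset hq₀ (prod_mono Ioo_subset_Icc_self Subset.rfl))
  set W : Set (ℝ × EuclideanSpace ℝ (Fin 3)) :=
    interior ({q | m / 2 < ‖u q.1 q.2‖} ∩ Ioo 0 T ×ˢ univ) with hW
  have hWn : W ∈ 𝓝 ((T / 2, x₁) : ℝ × EuclideanSpace ℝ (Fin 3)) :=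
    interior_mem_nhds.2 (inter_mem (hFat.preimage_mem_nhds (Ioi_mem_nhds (by linarith))) hq₀)
  have hWpos : 0 < volume W := Measure.measure_pos_of_mem_nhds _ hWn
  have hWsub : W ⊆ Ico 0 T ×ˢ univ :=
    interior_subset.trans (inter_subset_right.trans (prod_mono Ioo_subset_Ico_self Subset.rfl))
  intro h0
  have h1 : ∫⁻ q in Ico 0 T ×ˢ (univ : Set (EuclideanSpace ℝ (Fin 3))),
      W.indicator (fun _ => ENNReal.ofReal ((m / 2) ^ 3)) q ≤
      ∫⁻ q in Ico 0 T ×ˢ (univ : Set (EuclideanSpace ℝ (Fin 3))), ‖u q.1 q.2‖ₑ ^ (3 : ℕ) := by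
    refine lintegral_mono fun q => ?_
    by_cases hq : q ∈ W
    · rw [indicator_of_mem hq, ← ofReal_norm, ← ENNReal.ofReal_pow (norm_nonneg _)]
      exact ENNReal.ofReal_le_ofReal
        (pow_le_pow_left₀ (by linarith) ((interior_subset hq).1 : m / 2 < ‖u q.1 q.2‖).le 3)
    · rw [indicator_of_notMem hq]; exact bot_le
  rw [h0, lintegral_indicator_const isOpen_interior.measurableSet,
    Measure.restrict_apply isOpen_interior.measurableSet, inter_eq_left.2 hWsub] at h1
  rcases mul_eq_zero.1 (le_antisymm h1 bot_le) with h2 | h2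
  · exact (ENNReal.ofReal_pos.2 (by positivity)).ne' h2
  · exact hWpos.ne' h2

/-! ### (G4) The `L³` floor on the Euler cylinders `Q^{ρ}_r(T₀, x₀)` -/

/-- **(G4), the floor (3.1) of Seregin (arXiv:2402.13229) holds EXACTLY for the cascade**: there is
`ε₀ > 0` such that for every `δ > 0` some `r ∈ (0, δ)` has
`ε₀ ≤ r^{2ρ-2} ∫_{(T₀ - r^{2+ρ}, T₀) × B_r(x₀)} |𝔲|³`. Take `r_j = τʲ R` with `G ⊆ B(x₀, R)`,
`R ≥ T₀ + 1`: the `j`-th strip `[t_j, t_{j+1}) × B(x₀, τʲR)` lies in the Euler cylinder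
`Q^{ρ}_{r_j}` (`T₀ - t_j = σ^{2j} T₀ = (τʲ)^{2+ρ} T₀ < r_j^{2+ρ}`), carries
`∫∫|𝔲|³ = (a²τ⁴)ʲ L₃ = (τʲ)^{2-2ρ} L₃` (`setLIntegral_strip_enorm_glueG_pow`), and
`r_j^{2ρ-2} (τʲ)^{2-2ρ} = R^{2ρ-2}`: discrete self-similarity makes the normalised mass constant
along `r_j → 0`. [folklore] -/
theorem exists_eulerCylinder_L3_floor (h : IsSuperBlock T ν₀ τ σ a z G u)
    (hρ : a = τ ^ (-(1 + ρ))) :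
    ∃ ε₀ : ℝ, 0 < ε₀ ∧ ∀ δ : ℝ, 0 < δ → ∃ r ∈ Ioo 0 δ,
      ENNReal.ofReal ε₀ ≤ ENNReal.ofReal (r ^ (2 * ρ - 2)) *
        ∫⁻ w in Ioo (blowupTime T σ - r ^ (2 + ρ)) (blowupTime T σ) ×ˢ ball (blowupPoint τ z) r,
          ‖glueG T σ τ a z u w.1 w.2‖ₑ ^ (3 : ℕ) := by
  have hτ := h.τ_pos
  have hτ1 := h.τ_lt_one
  have hρ0 := h.powerExp_pos hρ
  have hT₀ := h.blowupTime_pos'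
  -- a radius `R ≥ 1, T₀ + 1` with `G ⊆ B(x₀, R)`
  obtain ⟨R₀, hR₀⟩ := h.isCompact.isBounded.subset_ball (blowupPoint τ z)
  set R : ℝ := max R₀ (blowupTime T σ + 1) with hRdef
  have hR1 : 1 ≤ R := le_max_of_le_right (by linarith)
  have hR0 : 0 < R := one_pos.trans_le hR1
  have hRG : G ⊆ ball (blowupPoint τ z) R := hR₀.trans (ball_subset_ball (le_max_left _ _))
  have hRT : blowupTime T σ < R ^ (2 + ρ) := by
    have h1 : R ^ (1 : ℝ) ≤ R ^ (2 + ρ) := Real.rpow_le_rpow_of_exponent_le hR1 (by linarith)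
    rw [Real.rpow_one] at h1
    exact (lt_of_lt_of_le (by linarith) (le_max_right _ _ : blowupTime T σ + 1 ≤ R)).trans_le h1
  -- the base mass `L₃ ∈ (0, ∞)` and the floor constant
  set L₃ : ℝ≥0∞ := ∫⁻ q in Ico 0 T ×ˢ (univ : Set (EuclideanSpace ℝ (Fin 3))),
    ‖u q.1 q.2‖ₑ ^ (3 : ℕ) with hL₃
  have hL₃top : L₃ ≠ ⊤ := (h.block.base_lt_top_norm_pow (by norm_num)).ne
  have hL₃0 : L₃ ≠ 0 := h.base_lintegral_norm_cube_ne_zero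
  have hRpow : 0 < R ^ (2 * ρ - 2) := Real.rpow_pos_of_pos hR0 _
  have hεtop : ENNReal.ofReal (R ^ (2 * ρ - 2)) * L₃ ≠ ⊤ := ENNReal.mul_ne_top ENNReal.ofReal_ne_top hL₃top
  have hε0 : ENNReal.ofReal (R ^ (2 * ρ - 2)) * L₃ ≠ 0 :=
    mul_ne_zero ((ENNReal.ofReal_pos.2 hRpow).ne') hL₃0
  refine ⟨(ENNReal.ofReal (R ^ (2 * ρ - 2)) * L₃).toReal, ENNReal.toReal_pos hε0 hεtop, fun δ hδ => ?_⟩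
  rw [ENNReal.ofReal_toReal hεtop]
  -- the scale `r = τʲ R < δ`
  obtain ⟨j, hj⟩ := exists_pow_lt_of_lt_one (div_pos hδ hR0) hτ1
  have hr0 : 0 < τ ^ j * R := mul_pos (pow_pos hτ j) hR0
  refine ⟨τ ^ j * R, ⟨hr0, by rwa [← lt_div_iff₀ hR0]⟩, ?_⟩
  -- the `j`-th strip lies in the Euler cylinder of radius `r`
  set Q : Set (ℝ × EuclideanSpace ℝ (Fin 3)) :=
    Ioo (blowupTime T σ - (τ ^ j * R) ^ (2 + ρ)) (blowupTime T σ) ×ˢ ball (blowupPoint τ z) (τ ^ j * R)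
    with hQ
  set S : Set (ℝ × EuclideanSpace ℝ (Fin 3)) :=
    Ico (switchTime T σ j) (switchTime T σ (j + 1)) ×ˢ (univ : Set (EuclideanSpace ℝ (Fin 3))) with hS
  have hSm : MeasurableSet S := measurableSet_Ico.prod MeasurableSet.univ
  have hsupp : support (S.indicator fun q : ℝ × EuclideanSpace ℝ (Fin 3) =>
      ‖glueG T σ τ a z u q.1 q.2‖ₑ ^ (3 : ℕ)) ⊆ Q := by
    intro q hq
    rw [mem_support, ne_eq, indicator_apply_eq_zero, Classical.not_imp] at hq
    obtain ⟨hqS, hq0⟩ := hq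
    have hqt : q.1 ∈ Ico (switchTime T σ j) (switchTime T σ (j + 1)) := (mem_prod.1 hqS).1
    have hne : glueG T σ τ a z u q.1 q.2 ≠ 0 := fun e => hq0 (by simp [e])
    refine mem_prod.2 ⟨⟨?_, hqt.2.trans (switchTime_lt_blowupTime h.T_pos h.σ_pos h.σ_lt_one _)⟩,
      mem_ball.2 (h.dist_lt_of_glueG_ne_zero hRG hqt hne)⟩
    have htj : switchTime T σ j = blowupTime T σ - σ ^ (2 * j) * blowupTime T σ :=
      h.switchTime_eq_blowupTime_sub j
    have hr : (τ ^ j * R) ^ (2 + ρ) = σ ^ (2 * j) * R ^ (2 + ρ) := by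
      rw [Real.mul_rpow (pow_nonneg hτ.le _) hR0.le, h.σ_pow_two_mul_eq_rpow hρ]
    rw [hr]
    have : σ ^ (2 * j) * blowupTime T σ < σ ^ (2 * j) * R ^ (2 + ρ) :=
      mul_lt_mul_of_pos_left hRT (pow_pos h.σ_pos _)
    linarith [hqt.1]
  have hmono : ∫⁻ q in S, ‖glueG T σ τ a z u q.1 q.2‖ₑ ^ (3 : ℕ) ≤
      ∫⁻ q in Q, ‖glueG T σ τ a z u q.1 q.2‖ₑ ^ (3 : ℕ) := by
    rw [← lintegral_indicator hSm, ← setLIntegral_eq_of_support_subset hsupp]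
    exact lintegral_mono fun q => indicator_le_self _ _ q
  -- the strip carries `(a²τ⁴)ʲ L₃ = (τʲ)^{2-2ρ} L₃`
  have hstrip : ∫⁻ q in S, ‖glueG T σ τ a z u q.1 q.2‖ₑ ^ (3 : ℕ) =
      ENNReal.ofReal ((τ ^ j) ^ (2 - 2 * ρ)) * L₃ := by
    rw [hS, h.setLIntegral_strip_enorm_glueG_pow j 3, ← hL₃]
    congr 2
    rw [show a ^ 3 * a⁻¹ * τ ^ 4 = a ^ 2 * τ ^ 4 by
        rw [pow_succ, mul_assoc (a ^ 2), mul_inv_cancel₀ h.gain_pos.ne', mul_one],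
      h.gain_sq_mul_pow_four_eq_rpow hρ, pow_rpow_comm hτ.le]
  have hnorm : ENNReal.ofReal ((τ ^ j * R) ^ (2 * ρ - 2)) * ENNReal.ofReal ((τ ^ j) ^ (2 - 2 * ρ)) =
      ENNReal.ofReal (R ^ (2 * ρ - 2)) := by
    have hs : 0 < τ ^ j := pow_pos hτ j
    rw [← ENNReal.ofReal_mul (Real.rpow_nonneg hr0.le _), Real.mul_rpow hs.le hR0.le,
      mul_right_comm, ← Real.rpow_add hs, show 2 * ρ - 2 + (2 - 2 * ρ) = 0 by ring, Real.rpow_zero,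
      one_mul]
  calc ENNReal.ofReal (R ^ (2 * ρ - 2)) * L₃
      = ENNReal.ofReal ((τ ^ j * R) ^ (2 * ρ - 2)) * ∫⁻ q in S, ‖glueG T σ τ a z u q.1 q.2‖ₑ ^ (3 : ℕ) := by
        rw [hstrip, ← mul_assoc, hnorm]
    _ ≤ ENNReal.ofReal ((τ ^ j * R) ^ (2 * ρ - 2)) * ∫⁻ q in Q, ‖glueG T σ τ a z u q.1 q.2‖ₑ ^ (3 : ℕ) :=
        mul_le_mul' le_rfl hmono

/-! ### The power-zoomable Type-II portrait -/

/-- **The super-similar NSI cascade is a power-zoomable Type-II portrait.** For an `IsSuperBlock`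
datum with power exponent `ρ` (`a = τ^{-(1+ρ)}`; necessarily `0 < ρ < 1/2`), at the blow-up point
`z₀ = (T₀, x₀)` of `𝔲 = glueG T σ τ a z u`:
(NSI) `𝔲` is a weak solution of the Navier–Stokes inequality for every `ν ∈ [0, ν₀]`;
(¬I) the blow-up at `T₀` is not of Type I;
(G2) `D𝔲` is a weak spatial gradient on `Q_{√T₀}(z₀)`;
(G3: A, E) `r^{2ρ} A(r; z₀) + r^{ρ} E(r; z₀) ≤ M` for ALL `r > 0`;
(G4) the `L³` floor on the Euler cylinders `Q^{ρ}_r(z₀)` along a sequence `r → 0`.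
These are the hypotheses of `SereginZoomReduction` / the second disjunct of `TypeIOrPowerZoomable`
(route `EulerZoomLiouville`) except the NS identity (G1) and the pressure gauge `D`.
[cite: Ozanski2017NSISingular, §2] -/
theorem powerZoomable_portrait (h : IsSuperBlock T ν₀ τ σ a z G u) (hρ : a = τ ^ (-(1 + ρ))) :
    (0 < ρ ∧ ρ < 1 / 2) ∧
    (∀ ν ∈ Icc 0 ν₀, IsWeakNSISolution ν (glueG T σ τ a z u)
      fun s => normalisedPressure (glueG T σ τ a z u s)) ∧
    ¬ IsTypeIBlowup (glueG T σ τ a z u) (blowupTime T σ) ∧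
    HasWeakSpatialGradientOn
      (parabolicCylinderOpens (Real.sqrt (blowupTime T σ)) (blowupTime T σ, blowupPoint τ z))
      (glueG T σ τ a z u) (fun s x => fderiv ℝ (glueG T σ τ a z u s) x) ∧
    (∃ M : ℝ, 0 ≤ M ∧ ∀ r : ℝ, 0 < r →
      ENNReal.ofReal (r ^ (2 * ρ)) * cknA r (blowupTime T σ, blowupPoint τ z) (glueG T σ τ a z u) +
        ENNReal.ofReal (r ^ ρ) *
          cknE r (blowupTime T σ, blowupPoint τ z) (fun s x => fderiv ℝ (glueG T σ τ a z u s) x) ≤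
        ENNReal.ofReal M) ∧
    (∃ ε₀ : ℝ, 0 < ε₀ ∧ ∀ δ : ℝ, 0 < δ → ∃ r ∈ Ioo 0 δ,
      ENNReal.ofReal ε₀ ≤ ENNReal.ofReal (r ^ (2 * ρ - 2)) *
        ∫⁻ w in Ioo (blowupTime T σ - r ^ (2 + ρ)) (blowupTime T σ) ×ˢ ball (blowupPoint τ z) r,
          ‖glueG T σ τ a z u w.1 w.2‖ₑ ^ (3 : ℕ)) := by
  obtain ⟨CA, hCA0, hCA⟩ := h.exists_powerGaugeA_le hρ
  obtain ⟨CE, hCE0, hCE⟩ := h.exists_powerGaugeE_le hρ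
  refine ⟨⟨h.powerExp_pos hρ, h.powerExp_lt_half hρ⟩, fun ν hν => h.isWeakNSISolution_glueG hν,
    not_isTypeIBlowup_glueG h.T_pos h.σ_pos h.σ_lt_one h.τ_pos.ne'
      ((one_half_lt_rateExp_iff h.σ_pos h.σ_lt_one h.gain_pos).1 h.rateExp_mem_Ioo.1) z
      h.block.nontrivial,
    h.hasWeakSpatialGradientOn_glueG_cylinder (by rw [Real.sq_sqrt h.blowupTime_pos'.le]) _,
    ⟨CA + CE, add_nonneg hCA0 hCE0, fun r hr => ?_⟩, h.exists_eulerCylinder_L3_floor hρ⟩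
  rw [ENNReal.ofReal_add hCA0 hCE0]
  exact add_le_add (hCA _ r hr) (hCE _ r hr)

/-- **Existence: a weak NSI solution with a power-zoomable Type-II portrait.** There are
`ρ ∈ (0, 1/2)`, `ν₀ > 0`, a compact `K` and a field `v` with `C^∞` slices supported in `K`, a weak
solution of the Navier–Stokes inequality for every `ν ∈ [0, ν₀]`, blowing up at some `T₀ > 0` NOT
of Type I, and a point `x₀` at which (G2), the `A`/`E` power-gauge bound (G3) at all scales and the
`L³` floor (G4) on the Euler cylinders of exponent `ρ` hold (`powerZoomable_portrait` for the
super-similar cascade of `exists_isSuperBlock_rateExp_eq`). [cite: Ozanski2017NSISingular, §2, §5] -/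
theorem exists_weakNSI_powerZoomable :
    ∃ ρ : ℝ, 0 < ρ ∧ ρ < 1 / 2 ∧ ∃ ν₀ : ℝ, 0 < ν₀ ∧
      ∃ (K : Set (EuclideanSpace ℝ (Fin 3)))
        (v : ℝ → EuclideanSpace ℝ (Fin 3) → EuclideanSpace ℝ (Fin 3))
        (Dv : ℝ → EuclideanSpace ℝ (Fin 3) → (EuclideanSpace ℝ (Fin 3) →L[ℝ] EuclideanSpace ℝ (Fin 3)))
        (p : ℝ → EuclideanSpace ℝ (Fin 3) → ℝ),
        IsCompact K ∧ (∀ ν ∈ Icc (0 : ℝ) ν₀, IsWeakNSISolution ν v p) ∧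
        (∀ t : ℝ, ContDiff ℝ ((⊤ : ℕ∞) : WithTop ℕ∞) (v t) ∧ tsupport (v t) ⊆ K) ∧
        ∃ (T₀ : ℝ) (x₀ : EuclideanSpace ℝ (Fin 3)), 0 < T₀ ∧ ¬ IsTypeIBlowup v T₀ ∧
          HasWeakSpatialGradientOn (parabolicCylinderOpens (Real.sqrt T₀) (T₀, x₀)) v Dv ∧
          (∃ M : ℝ, 0 ≤ M ∧ ∀ r : ℝ, 0 < r →
            ENNReal.ofReal (r ^ (2 * ρ)) * cknA r (T₀, x₀) v +
              ENNReal.ofReal (r ^ ρ) * cknE r (T₀, x₀) Dv ≤ ENNReal.ofReal M) ∧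
          (∃ ε₀ : ℝ, 0 < ε₀ ∧ ∀ δ : ℝ, 0 < δ → ∃ r ∈ Ioo 0 δ,
            ENNReal.ofReal ε₀ ≤ ENNReal.ofReal (r ^ (2 * ρ - 2)) *
              ∫⁻ w in Ioo (T₀ - r ^ (2 + ρ)) T₀ ×ˢ ball x₀ r, ‖v w.1 w.2‖ₑ ^ (3 : ℕ)) := by
  obtain ⟨β₀, hβ₀, -, hreach⟩ := exists_isSuperBlock_rateExp_eq
  obtain ⟨T, ν₀, τ, σ, a, z, G, u, hS, -⟩ := hreach β₀ ⟨hβ₀, le_rfl⟩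
  have hρ := hS.gain_eq_rpow
  obtain ⟨⟨hρ0, hρ1⟩, hNSI, hI, hG2, hG3, hG4⟩ := hS.powerZoomable_portrait hρ
  exact ⟨_, hρ0, hρ1, ν₀, hS.block.ν₀_pos, G, glueG T σ τ a z u,
    fun s x => fderiv ℝ (glueG T σ τ a z u s) x, fun s => normalisedPressure (glueG T σ τ a z u s),
    hS.block.isCompact, hNSI, fun t => ⟨hS.contDiff_glueG_slice t, hS.tsupport_glueG_slice_subset t⟩,
    blowupTime T σ, blowupPoint τ z, hS.blowupTime_pos', hI, hG2, hG3, hG4⟩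

end IsSuperBlock

end Summit.NavierStokesRegularity.NavierStokesRegularity.Theorems.TypeIliouvilleNoTypeIINegative

end
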